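import Literature.NumberTheory.Transcendental.MasserLemma22
import Literature.NumberTheory.EllipticCurves.WeierstrassAdditionProofs
import Literature.NumberTheory.Transcendental.ChudnovskyPeriods
import HarnessLib

/-!
# Masser 1975, Lemma 2.4 (the Main Lemma) — preliminaries

Support for the book's own proof (Ch. II) of
`Literature.NumberTheory.Transcendental.masser_ellipticPeriods` (Masser 1975, Theorem II).

D. W. Masser, *Elliptic Functions and Transcendence*, LNM 437 (1975), Ch. II §2.3, Lemma 2.4
(pp. 19–21): for `f(z) = β₁(ζ(ω₁z) - η₁z) + β₂(ζ(ω₂z) - η₂z)` and a polynomial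
`φ(z) = ∑ p(λ₀,λ₁,λ₂) f^{λ₀} ℘(ω₁z)^{λ₁} ℘(ω₂z)^{λ₂}`, the coefficients are bounded by
`(c₁₂L)^{c₁₃L}` times the maximum of `|φ|` on `ξ ∩ {|z| ≤ c₁₄ exp((log L)^{36})}`.

This file contains the algebra and the local analysis of the proof:
* the functions `gq i z = ζ(ωᵢz) - ηᵢz` and their behaviour under the translations
  `z ↦ z + Mτ` of the proof (eqs. (21), (22), (24), (25)), with the Legendre constant
  `κ = η₁ω₂ - η₂ω₁ = ±2πi`;
* the identities `βτ = D/F + ω₂Δ/(κβ₂F)`, `β + τ = -E/F + ε/(ω₁ω₂F) + ω₁Δ/(κβ₂F)` and the lower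
  bound for `|Δ|` ((27)–(28));
* the second-order Taylor bound for `℘(ωᵢ(¼ + u))`;
* the inversion of the substitution `xᵢ ↦ aᵢ + bᵢxᵢ` in a polynomial of three variables.

Everything here is proved; no named facts.

## References

* D. W. Masser, *Elliptic Functions and Transcendence*, Lecture Notes in Math. 437, Springer 1975,
  Ch. II §2.3, Lemma 2.4 (pp. 19–21). [Masser1975]
-/

noncomputable section

open Complex Metric Set Real Filter Finset
open scoped PeriodPair

namespace Literature.NumberTheory.Transcendental.Masser1975

variable (L : PeriodPair)

/-! ### The functions `gᵢ(z) = ζ(ωᵢ z) - ηᵢ z` and the Legendre constant -/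

/-- `g i z = ζ(ωᵢ z) - ηᵢ z` (period `1` in `z`). [cite: Masser1975, §2.3 (proof of Lemma 2.4, gᵢ)] -/
def gq (i : Fin 2) (z : ℂ) : ℂ := L.weierstrassZeta (L.basis i * z) - L.quasiPeriod i * z

/-- The Legendre constant `κ = η₁ω₂ - η₂ω₁`. [folklore] -/
def κL : ℂ := L.η₁ * L.ω₂ - L.η₂ * L.ω₁

/-- `κ = ±2πi`. [cite: Masser1975, §2.3 ("on using the Legendre relation ω₂η₁ - ω₁η₂ = 2πi")] -/
theorem κL_eq_or : κL L = 2 * Real.pi * I ∨ κL L = -(2 * Real.pi * I) := by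
  rcases PeriodPair.legendre_relation_or (L := L) (fun L' => L'.legendre_relation_holds) with h | h
  · exact Or.inl h
  · right; unfold κL; linear_combination -h

/-- `‖κ‖ = 2π`. [folklore] -/
theorem norm_κL : ‖κL L‖ = 2 * Real.pi := by
  have h2π : ‖(2 * Real.pi * I : ℂ)‖ = 2 * Real.pi := by
    rw [norm_mul, norm_mul, Complex.norm_I, mul_one, Complex.norm_real, Complex.norm_ofNat,
      Real.norm_eq_abs, abs_of_pos Real.pi_pos]
  rcases κL_eq_or L with h | h
  · rw [h, h2π]
  · rw [h, norm_neg, h2π]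

/-- `κ ≠ 0`. [folklore] -/
theorem κL_ne_zero : κL L ≠ 0 := by
  intro h
  have := norm_κL L
  rw [h, norm_zero] at this
  linarith [Real.pi_pos]

/-- **(21)/(24)**: `g₁(w + Mτ) = g₁(w) - Mκ/ω₁` (`ω₁(w + Mτ) = ω₁w + Mω₂`). [cite: Masser1975, §2.3 eq. (24)] -/
theorem gq_zero_add_int_mul_tau (w : ℂ) (M : ℤ) :
    gq L 0 (w + M * (L.ω₂ / L.ω₁)) = gq L 0 w - M * κL L / L.ω₁ := by
  have hω₁ : L.ω₁ ≠ 0 := by simpa using basis_ne_zero L 0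
  unfold gq κL
  simp only [PeriodPair.basis_zero, PeriodPair.quasiPeriod_zero]
  have h1 : L.ω₁ * (w + M * (L.ω₂ / L.ω₁)) = L.ω₁ * w + ((0 : ℤ) * L.ω₁ + M * L.ω₂) := by
    field_simp; push_cast; ring
  rw [h1, L.weierstrassZeta_add_period]
  field_simp
  push_cast
  ring

/-- **(22)**: with `δ = Aω₁² + Bω₁ω₂ + Cω₂²`, `ε = Dω₁² + Eω₁ω₂ + Fω₂²` and `M = mC + r₀F`,
`ω₂(w + Mτ) = ω₂ w' + l` where `w' = w + (mδ + r₀ε)/(ω₁ω₂)` and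
`l = -(mA + r₀D)ω₁ - (mB + r₀E)ω₂ ∈ Λ`. [cite: Masser1975, §2.3 eq. (22)] -/
theorem ω₂_mul_add_int_mul_tau (w : ℂ) (A B C D E F m r₀ : ℤ) :
    L.ω₂ * (w + ((m * C + r₀ * F : ℤ) : ℂ) * (L.ω₂ / L.ω₁)) =
      L.ω₂ * (w + ((m : ℂ) * periodForm L (A, B, C) + (r₀ : ℂ) * periodForm L (D, E, F)) / (L.ω₁ * L.ω₂)) +
        ((-(m * A + r₀ * D) : ℤ) * L.ω₁ + (-(m * B + r₀ * E) : ℤ) * L.ω₂) := by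
  have hω₁ : L.ω₁ ≠ 0 := by simpa using basis_ne_zero L 0
  have hω₂ : L.ω₂ ≠ 0 := by simpa using basis_ne_zero L 1
  unfold periodForm
  simp only
  field_simp
  push_cast
  ring

/-- **(25)**: `g₂(w + Mτ) = g₂(w') - (mA + r₀D)κ/ω₂`. [cite: Masser1975, §2.3 eq. (25)] -/
theorem gq_one_add_int_mul_tau (w : ℂ) (A B C D E F m r₀ : ℤ) :
    gq L 1 (w + ((m * C + r₀ * F : ℤ) : ℂ) * (L.ω₂ / L.ω₁)) =
      gq L 1 (w + ((m : ℂ) * periodForm L (A, B, C) + (r₀ : ℂ) * periodForm L (D, E, F)) / (L.ω₁ * L.ω₂)) -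
        ((m * A + r₀ * D : ℤ) : ℂ) * κL L / L.ω₂ := by
  have hω₁ : L.ω₁ ≠ 0 := by simpa using basis_ne_zero L 0
  have hω₂ : L.ω₂ ≠ 0 := by simpa using basis_ne_zero L 1
  unfold gq
  simp only [PeriodPair.basis_one, PeriodPair.quasiPeriod_one]
  rw [ω₂_mul_add_int_mul_tau L w A B C D E F m r₀, L.weierstrassZeta_add_period]
  unfold κL periodForm
  simp only
  field_simp
  push_cast
  ring

/-- **`f(Z) = [β₁g₁(w) + β₂g₂(w') - mκ(β₁C/ω₁ + β₂A/ω₂)] + r₀Δ`** with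
`Δ = -κ(β₁F/ω₁ + β₂D/ω₂)`. [cite: Masser1975, §2.3 eq. (26) (the main term r₀Δ)] -/
theorem fβ_add_int_mul_tau (β₁ β₂ w : ℂ) (A B C D E F m r₀ : ℤ) :
    β₁ * gq L 0 (w + ((m * C + r₀ * F : ℤ) : ℂ) * (L.ω₂ / L.ω₁)) +
      β₂ * gq L 1 (w + ((m * C + r₀ * F : ℤ) : ℂ) * (L.ω₂ / L.ω₁)) =
      (β₁ * gq L 0 w +
        β₂ * gq L 1 (w + ((m : ℂ) * periodForm L (A, B, C) + (r₀ : ℂ) * periodForm L (D, E, F)) / (L.ω₁ * L.ω₂)) -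
        (m : ℂ) * κL L * (β₁ * C / L.ω₁ + β₂ * A / L.ω₂)) +
      (r₀ : ℂ) * (-κL L * (β₁ * F / L.ω₁ + β₂ * D / L.ω₂)) := by
  have hω₁ : L.ω₁ ≠ 0 := by simpa using basis_ne_zero L 0
  have hω₂ : L.ω₂ ≠ 0 := by simpa using basis_ne_zero L 1
  rw [gq_zero_add_int_mul_tau, gq_one_add_int_mul_tau L w A B C D E F m r₀]
  field_simp
  push_cast
  ring

/-! ### The lower bound for `Δ` -/

/-- **The identities (27)**: with `β = -β₁/β₂`, `τ = ω₂/ω₁`, `ε = Dω₁² + Eω₁ω₂ + Fω₂²`, `F ≠ 0`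
and `Δ = -κ(β₁F/ω₁ + β₂D/ω₂)`: `βτ = D/F + ω₂Δ/(κβ₂F)` and
`β + τ = -E/F + ε/(ω₁ω₂F) + ω₁Δ/(κβ₂F)`. [cite: Masser1975, §2.3 eq. (27)] -/
theorem βτ_identities {β₁ β₂ : ℂ} (hβ₂ : β₂ ≠ 0) (D E F : ℤ) (hF : F ≠ 0) :
    (-β₁ / β₂) * (L.ω₂ / L.ω₁) = (D : ℂ) / F +
        L.ω₂ * (-κL L * (β₁ * F / L.ω₁ + β₂ * D / L.ω₂)) / (κL L * β₂ * F) ∧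
      (-β₁ / β₂) + L.ω₂ / L.ω₁ = -(E : ℂ) / F + periodForm L (D, E, F) / (L.ω₁ * L.ω₂ * F) +
        L.ω₁ * (-κL L * (β₁ * F / L.ω₁ + β₂ * D / L.ω₂)) / (κL L * β₂ * F) := by
  have hω₁ : L.ω₁ ≠ 0 := by simpa using basis_ne_zero L 0
  have hω₂ : L.ω₂ ≠ 0 := by simpa using basis_ne_zero L 1
  have hκ := κL_ne_zero L
  have hFc : (F : ℂ) ≠ 0 := by exact_mod_cast hF
  unfold periodForm
  simp only
  constructor
  · field_simp; ring
  · field_simp; ring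

/-- **Not both `Im(βτ)` and `Im(β + τ)` vanish** when `β̄ ≠ τ` (and `τ ∉ ℝ`): otherwise `β, τ`
would be the two roots of a real quadratic. [cite: Masser1975, §2.3 ("β and τ are not complex conjugates, and since τ is not real …")] -/
theorem im_ne_zero_or {β τ : ℂ} (hτ : τ.im ≠ 0) (hconj : (starRingEnd ℂ) β ≠ τ) :
    (β * τ).im ≠ 0 ∨ (β + τ).im ≠ 0 := by
  by_contra h
  push Not at h
  obtain ⟨hp, hs⟩ := h
  -- `τ² - sτ + p = 0` with real `s = β + τ`, `p = βτ`; conjugating, `τ̄` is a root too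
  have hp' : β.re * τ.im + β.im * τ.re = 0 := by simpa [Complex.mul_im] using hp
  have hs' : β.im + τ.im = 0 := by simpa [Complex.add_im] using hs
  have hβim : β.im = -τ.im := by linarith
  rw [hβim] at hp'
  have hre : β.re = τ.re := by
    have : (β.re - τ.re) * τ.im = 0 := by linarith
    rcases mul_eq_zero.mp this with h | h
    · linarith
    · exact absurd h hτ
  apply hconj
  apply Complex.ext <;> simp [hre, hβim]

/-- `Im(D/F) = 0` for integers. [folklore] -/
theorem im_intCast_div_intCast (D F : ℤ) : ((D : ℂ) / (F : ℂ)).im = 0 := by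
  rw [Complex.div_im]; simp

/-- **The lower bound (28) for `Δ`**: for `β₂ ≠ 0` and `β̄₁ω₁ + β̄₂ω₂ ≠ 0` there are `c > 0` and
`c'` with `c |F| - c' ≤ |Δ|` whenever `|ε| ≤ 1`, `F ≠ 0`.
[cite: Masser1975, §2.3 ("|Δ| ≥ c₂₀|F| - 1")] -/
theorem norm_Δ_ge (β₁ β₂ : ℂ) (hβ₂ : β₂ ≠ 0)
    (hconj : (starRingEnd ℂ) β₁ * L.ω₁ + (starRingEnd ℂ) β₂ * L.ω₂ ≠ 0) :
    ∃ c c' : ℝ, 0 < c ∧ ∀ D E F : ℤ, F ≠ 0 → ‖periodForm L (D, E, F)‖ ≤ 1 →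
      c * |(F : ℝ)| - c' ≤ ‖-κL L * (β₁ * F / L.ω₁ + β₂ * D / L.ω₂)‖ := by
  have hω₁ : L.ω₁ ≠ 0 := by simpa using basis_ne_zero L 0
  have hω₂ : L.ω₂ ≠ 0 := by simpa using basis_ne_zero L 1
  have hκ := κL_ne_zero L
  set τ := L.ω₂ / L.ω₁ with hτ
  set β := -β₁ / β₂ with hβ
  have hτim : τ.im ≠ 0 := im_tau_ne_zero L
  have hconj' : (starRingEnd ℂ) β ≠ τ := by
    intro h
    apply hconj
    have hβ₂' : (starRingEnd ℂ) β₂ ≠ 0 := by simpa using hβ₂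
    have : (starRingEnd ℂ) β = -(starRingEnd ℂ) β₁ / (starRingEnd ℂ) β₂ := by
      rw [hβ, map_div₀, map_neg]
    rw [this] at h
    rw [hτ] at h
    field_simp at h
    linear_combination -h
  -- the positive constant `κ₀ = max |Im(βτ)| |Im(β+τ)|`
  set κ₀ : ℝ := max |(β * τ).im| |(β + τ).im| with hκ₀
  have hκ₀0 : 0 < κ₀ := by
    rcases im_ne_zero_or hτim hconj' with h | h
    · exact lt_of_lt_of_le (abs_pos.mpr h) (le_max_left _ _)
    · exact lt_of_lt_of_le (abs_pos.mpr h) (le_max_right _ _)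
  -- constants
  set cΔ : ℝ := (‖L.ω₁‖ + ‖L.ω₂‖) / (‖κL L‖ * ‖β₂‖) with hcΔ
  have hβ₂0 : 0 < ‖β₂‖ := norm_pos_iff.mpr hβ₂
  have hκ0 : 0 < ‖κL L‖ := norm_pos_iff.mpr hκ
  have hcΔ0 : 0 < cΔ := by rw [hcΔ]; have := norm_pos_iff.mpr hω₁; positivity
  refine ⟨κ₀ / cΔ, (‖L.ω₁ * L.ω₂‖)⁻¹ / cΔ, by positivity, fun D E F hF hε => ?_⟩
  set Δ := -κL L * (β₁ * F / L.ω₁ + β₂ * D / L.ω₂) with hΔ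
  obtain ⟨h1, h2⟩ := βτ_identities L hβ₂ D E F hF
  rw [← hτ, ← hβ, ← hΔ] at h1 h2
  clear_value Δ
  have hFc : (F : ℂ) ≠ 0 := by exact_mod_cast hF
  have hF1 : 0 < |(F : ℝ)| := by exact_mod_cast abs_pos.mpr hF
  -- `|Im(βτ)| |F| ≤ |ω₂| |Δ| / (|κ| |β₂|)`
  have e1 : |(β * τ).im| * |(F : ℝ)| ≤ ‖L.ω₂‖ * ‖Δ‖ / (‖κL L‖ * ‖β₂‖) := by
    have him : (β * τ).im = (L.ω₂ * Δ / (κL L * β₂ * F)).im := by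
      rw [h1, Complex.add_im, im_intCast_div_intCast, zero_add]
    rw [him]
    have hn : ‖L.ω₂ * Δ / (κL L * β₂ * F)‖ = ‖L.ω₂‖ * ‖Δ‖ / (‖κL L‖ * ‖β₂‖ * |(F : ℝ)|) := by
      rw [norm_div, norm_mul, norm_mul, norm_mul, Complex.norm_intCast]
    calc |(L.ω₂ * Δ / (κL L * β₂ * F)).im| * |(F : ℝ)| ≤ ‖L.ω₂ * Δ / (κL L * β₂ * F)‖ * |(F : ℝ)| :=
          mul_le_mul_of_nonneg_right (Complex.abs_im_le_norm _) (abs_nonneg _)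
      _ = ‖L.ω₂‖ * ‖Δ‖ / (‖κL L‖ * ‖β₂‖) := by rw [hn]; field_simp
  -- `|Im(β+τ)| |F| ≤ |ε|/|ω₁ω₂| + |ω₁| |Δ| / (|κ| |β₂|)`
  have e2 : |(β + τ).im| * |(F : ℝ)| ≤ ‖periodForm L (D, E, F)‖ / ‖L.ω₁ * L.ω₂‖ +
      ‖L.ω₁‖ * ‖Δ‖ / (‖κL L‖ * ‖β₂‖) := by
    have him : (β + τ).im = (periodForm L (D, E, F) / (L.ω₁ * L.ω₂ * F) + L.ω₁ * Δ / (κL L * β₂ * F)).im := by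
      rw [h2, Complex.add_im, Complex.add_im, Complex.add_im, show (-(E : ℂ) / F) = ((-E : ℤ) : ℂ) / F by push_cast; ring,
        im_intCast_div_intCast, zero_add]
    rw [him]
    have hn1 : ‖periodForm L (D, E, F) / (L.ω₁ * L.ω₂ * F)‖ = ‖periodForm L (D, E, F)‖ / (‖L.ω₁ * L.ω₂‖ * |(F : ℝ)|) := by
      rw [norm_div, norm_mul, Complex.norm_intCast]
    have hn2 : ‖L.ω₁ * Δ / (κL L * β₂ * F)‖ = ‖L.ω₁‖ * ‖Δ‖ / (‖κL L‖ * ‖β₂‖ * |(F : ℝ)|) := by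
      rw [norm_div, norm_mul, norm_mul, norm_mul, Complex.norm_intCast]
    have hω12 : 0 < ‖L.ω₁ * L.ω₂‖ := norm_pos_iff.mpr (mul_ne_zero hω₁ hω₂)
    calc |(periodForm L (D, E, F) / (L.ω₁ * L.ω₂ * F) + L.ω₁ * Δ / (κL L * β₂ * F)).im| * |(F : ℝ)|
        ≤ ‖periodForm L (D, E, F) / (L.ω₁ * L.ω₂ * F) + L.ω₁ * Δ / (κL L * β₂ * F)‖ * |(F : ℝ)| :=
          mul_le_mul_of_nonneg_right (Complex.abs_im_le_norm _) (abs_nonneg _)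
      _ ≤ (‖periodForm L (D, E, F) / (L.ω₁ * L.ω₂ * F)‖ + ‖L.ω₁ * Δ / (κL L * β₂ * F)‖) * |(F : ℝ)| :=
          mul_le_mul_of_nonneg_right (norm_add_le _ _) (abs_nonneg _)
      _ = ‖periodForm L (D, E, F)‖ / ‖L.ω₁ * L.ω₂‖ + ‖L.ω₁‖ * ‖Δ‖ / (‖κL L‖ * ‖β₂‖) := by
          rw [hn1, hn2]; field_simp
  -- combine
  have e3 : κ₀ * |(F : ℝ)| ≤ (‖L.ω₁ * L.ω₂‖)⁻¹ + cΔ * ‖Δ‖ := by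
    have hω12 : 0 < ‖L.ω₁ * L.ω₂‖ := norm_pos_iff.mpr (mul_ne_zero hω₁ hω₂)
    have hεb : ‖periodForm L (D, E, F)‖ / ‖L.ω₁ * L.ω₂‖ ≤ (‖L.ω₁ * L.ω₂‖)⁻¹ := by
      rw [div_le_iff₀ hω12, inv_mul_cancel₀ hω12.ne']; exact hε
    have hsum : ‖L.ω₂‖ * ‖Δ‖ / (‖κL L‖ * ‖β₂‖) + ‖L.ω₁‖ * ‖Δ‖ / (‖κL L‖ * ‖β₂‖) = cΔ * ‖Δ‖ := by
      rw [hcΔ]; field_simp; ring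
    have hκle : κ₀ ≤ |(β * τ).im| + |(β + τ).im| :=
      max_le (le_add_of_nonneg_right (abs_nonneg _)) (le_add_of_nonneg_left (abs_nonneg _))
    have hκF : κ₀ * |(F : ℝ)| ≤ |(β * τ).im| * |(F : ℝ)| + |(β + τ).im| * |(F : ℝ)| := by
      have := mul_le_mul_of_nonneg_right hκle (abs_nonneg (F : ℝ)); linarith
    linarith [e1, e2, hεb, hsum, hκF]
  rw [div_mul_eq_mul_div, sub_le_iff_le_add, div_le_iff₀ hcΔ0]
  calc κ₀ * |(F : ℝ)| ≤ (‖L.ω₁ * L.ω₂‖)⁻¹ + cΔ * ‖Δ‖ := e3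
    _ = (‖Δ‖ + (‖L.ω₁ * L.ω₂‖)⁻¹ / cΔ) * cΔ := by field_simp; ring

/-! ### The second-order Taylor bound for `℘(ωᵢ(¼ + u))` -/

/-- **Taylor to second order at `¼`**: on the disc `𝒟`,
`‖℘(ωᵢ(¼+u)) - ℘(ωᵢ/4) - ωᵢ℘'(ωᵢ/4) u‖ ≤ C ‖u‖²` (mean value inequality twice, `℘'' = 6℘² - g₂/2`
bounded on `𝒟`). [cite: Masser1975, §2.3 ("From the power series expansion of ℘(ω₁z) about z = ¼ …")] -/
theorem scaledP_taylor_two (d : DiscData L) (i : Fin 2) : ∃ C : ℝ, 0 ≤ C ∧ ∀ u : ℂ, ‖u‖ ≤ d.ρ →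
    ‖scaledP L i (1 / 4 + u) - scaledP L i (1 / 4) - (L.basis i * ℘'[L] (L.basis i / 4)) * u‖ ≤
      C * ‖u‖ ^ 2 := by
  set ω := L.basis i with hω
  obtain ⟨B, hB1, hB⟩ := exists_bound_scaledP d i
  set K : ℝ := ‖ω‖ ^ 2 * (6 * B ^ 2 + ‖L.g₂‖ / 2) with hK
  have hK0 : 0 ≤ K := by positivity
  refine ⟨K, hK0, fun u hu => ?_⟩
  -- the first derivative `F'(z) = ω ℘'(ω z)` and its derivative `ω²(6℘² - g₂/2)`
  set F₁ : ℂ → ℂ := fun z => ω * ℘'[L] (ω * z) with hF₁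
  have hreg : ∀ z ∈ closedBall (1 / 4 : ℂ) d.ρ, ω * z ∉ L.lattice := fun z hz => d.regular i z hz
  have hF₁deriv : ∀ z ∈ closedBall (1 / 4 : ℂ) d.ρ,
      HasDerivAt F₁ (ω * (ω * (6 * ℘[L] (ω * z) ^ 2 - L.g₂ / 2))) z := fun z hz =>
    (hasDerivAt_derivWeierstrassP_mul (L := L) ω (hreg z hz)).const_mul ω
  have hF₁bound : ∀ z ∈ closedBall (1 / 4 : ℂ) d.ρ, ‖ω * (ω * (6 * ℘[L] (ω * z) ^ 2 - L.g₂ / 2))‖ ≤ K := by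
    intro z hz
    have hP : ‖℘[L] (ω * z)‖ ≤ B := hB z hz
    rw [norm_mul, norm_mul, ← mul_assoc, ← pow_two, hK]
    refine mul_le_mul_of_nonneg_left ?_ (by positivity)
    calc ‖6 * ℘[L] (ω * z) ^ 2 - L.g₂ / 2‖ ≤ ‖6 * ℘[L] (ω * z) ^ 2‖ + ‖L.g₂ / 2‖ := norm_sub_le _ _
      _ ≤ 6 * B ^ 2 + ‖L.g₂‖ / 2 := by
          rw [norm_mul, norm_pow, norm_div, Complex.norm_ofNat, Complex.norm_ofNat]
          gcongr
  have hconv : Convex ℝ (closedBall (1 / 4 : ℂ) d.ρ) := convex_closedBall _ _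
  have hc : (1 / 4 : ℂ) ∈ closedBall (1 / 4 : ℂ) d.ρ := mem_closedBall_self d.ρ_pos.le
  have hcu : (1 / 4 : ℂ) + u ∈ closedBall (1 / 4 : ℂ) d.ρ := by
    rw [mem_closedBall_iff_norm, add_sub_cancel_left]; exact hu
  -- MVT for `F₁`: `‖F₁ z - F₁ ¼‖ ≤ K ‖z - ¼‖` on `𝒟`
  have hmvt1 : ∀ z ∈ closedBall (1 / 4 : ℂ) d.ρ, ‖F₁ z - F₁ (1 / 4)‖ ≤ K * ‖z - 1 / 4‖ := fun z hz =>
    hconv.norm_image_sub_le_of_norm_hasDerivWithin_le (fun w hw => (hF₁deriv w hw).hasDerivWithinAt)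
      hF₁bound hc hz
  -- MVT for `G(z) = ℘(ω z) - F₁(¼) z` on the smaller disc of radius `‖u‖`
  set G : ℂ → ℂ := fun z => scaledP L i z - F₁ (1 / 4) * z with hG
  have hsub : closedBall (1 / 4 : ℂ) ‖u‖ ⊆ closedBall (1 / 4 : ℂ) d.ρ := closedBall_subset_closedBall hu
  have hGderiv : ∀ z ∈ closedBall (1 / 4 : ℂ) ‖u‖, HasDerivAt G (F₁ z - F₁ (1 / 4)) z := by
    intro z hz
    have h1 : HasDerivAt (scaledP L i) (F₁ z) z := hasDerivAt_scaledP L i (hreg z (hsub hz))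
    have h2 : HasDerivAt (fun w : ℂ => F₁ (1 / 4) * w) (F₁ (1 / 4)) z := by
      simpa using (hasDerivAt_id z).const_mul (F₁ (1 / 4))
    exact h1.sub h2
  have hGbound : ∀ z ∈ closedBall (1 / 4 : ℂ) ‖u‖, ‖F₁ z - F₁ (1 / 4)‖ ≤ K * ‖u‖ := by
    intro z hz
    refine (hmvt1 z (hsub hz)).trans (mul_le_mul_of_nonneg_left ?_ hK0)
    exact mem_closedBall_iff_norm.mp hz
  have hconv' : Convex ℝ (closedBall (1 / 4 : ℂ) ‖u‖) := convex_closedBall _ _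
  have hc' : (1 / 4 : ℂ) ∈ closedBall (1 / 4 : ℂ) ‖u‖ := mem_closedBall_self (norm_nonneg _)
  have hcu' : (1 / 4 : ℂ) + u ∈ closedBall (1 / 4 : ℂ) ‖u‖ := by
    rw [mem_closedBall_iff_norm, add_sub_cancel_left]
  have hmvt2 := hconv'.norm_image_sub_le_of_norm_hasDerivWithin_le
    (fun w hw => (hGderiv w hw).hasDerivWithinAt) hGbound hc' hcu'
  rw [add_sub_cancel_left] at hmvt2
  have hsplit : scaledP L i (1 / 4 + u) - scaledP L i (1 / 4) - (ω * ℘'[L] (ω / 4)) * u =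
      G (1 / 4 + u) - G (1 / 4) := by
    simp only [hG, hF₁]
    rw [show ω * (1 / 4 : ℂ) = ω / 4 by ring]
    ring
  rw [hsplit]
  calc ‖G (1 / 4 + u) - G (1 / 4)‖ ≤ K * ‖u‖ * ‖u‖ := hmvt2
    _ = K * ‖u‖ ^ 2 := by ring

/-! ### Polynomials in three variables: flattening, sizes, affine substitutions -/

/-- `triEval` as a flat triple sum. [folklore] -/
theorem triEval_eq_sum (N : ℕ) (p : ℕ → ℕ → ℕ → ℂ) (z₁ z₂ z₃ : ℂ) :
    triEval N p z₁ z₂ z₃ = ∑ i ∈ range (N + 1), ∑ j ∈ range (N + 1), ∑ l ∈ range (N + 1),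
      p i j l * z₁ ^ i * z₂ ^ j * z₃ ^ l := by
  unfold triEval
  refine Finset.sum_congr rfl fun i _ => ?_
  rw [Finset.sum_mul]
  refine Finset.sum_congr rfl fun j _ => ?_
  rw [Finset.sum_mul, Finset.sum_mul]
  refine Finset.sum_congr rfl fun l _ => ?_
  ring

/-- **Size of a polynomial from its coefficients**: `‖φ(z)‖ ≤ (N+1)³ P X^{3N}` if `‖p‖ ≤ P`,
`‖zₖ‖ ≤ X`, `X ≥ 1`. [folklore] -/
theorem norm_triEval_le {N : ℕ} {p : ℕ → ℕ → ℕ → ℂ} {P X : ℝ} (hP0 : 0 ≤ P) (hX : 1 ≤ X)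
    (hP : ∀ i j l, i ≤ N → j ≤ N → l ≤ N → ‖p i j l‖ ≤ P) {z₁ z₂ z₃ : ℂ}
    (h1 : ‖z₁‖ ≤ X) (h2 : ‖z₂‖ ≤ X) (h3 : ‖z₃‖ ≤ X) :
    ‖triEval N p z₁ z₂ z₃‖ ≤ ((N : ℝ) + 1) ^ 3 * P * X ^ (3 * N) := by
  rw [triEval_eq_sum]
  have hterm : ∀ i ∈ range (N + 1), ∀ j ∈ range (N + 1), ∀ l ∈ range (N + 1),
      ‖p i j l * z₁ ^ i * z₂ ^ j * z₃ ^ l‖ ≤ P * X ^ (3 * N) := by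
    intro i hi j hj l hl
    have hi' := Nat.lt_succ_iff.mp (Finset.mem_range.mp hi)
    have hj' := Nat.lt_succ_iff.mp (Finset.mem_range.mp hj)
    have hl' := Nat.lt_succ_iff.mp (Finset.mem_range.mp hl)
    rw [norm_mul, norm_mul, norm_mul, norm_pow, norm_pow, norm_pow]
    have e1 : ‖z₁‖ ^ i ≤ X ^ N := (pow_le_pow_left₀ (norm_nonneg _) h1 i).trans (pow_le_pow_right₀ hX hi')
    have e2 : ‖z₂‖ ^ j ≤ X ^ N := (pow_le_pow_left₀ (norm_nonneg _) h2 j).trans (pow_le_pow_right₀ hX hj')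
    have e3 : ‖z₃‖ ^ l ≤ X ^ N := (pow_le_pow_left₀ (norm_nonneg _) h3 l).trans (pow_le_pow_right₀ hX hl')
    calc ‖p i j l‖ * ‖z₁‖ ^ i * ‖z₂‖ ^ j * ‖z₃‖ ^ l ≤ P * X ^ N * X ^ N * X ^ N :=
          mul_le_mul (mul_le_mul (mul_le_mul (hP i j l hi' hj' hl') e1 (by positivity) hP0) e2
            (by positivity) (by positivity)) e3 (by positivity) (by positivity)
      _ = P * X ^ (3 * N) := by ring
  calc ‖∑ i ∈ range (N + 1), ∑ j ∈ range (N + 1), ∑ l ∈ range (N + 1), p i j l * z₁ ^ i * z₂ ^ j * z₃ ^ l‖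
      ≤ ∑ i ∈ range (N + 1), ∑ j ∈ range (N + 1), ∑ l ∈ range (N + 1), ‖p i j l * z₁ ^ i * z₂ ^ j * z₃ ^ l‖ := by
        refine (norm_sum_le _ _).trans (Finset.sum_le_sum fun i _ => ?_)
        refine (norm_sum_le _ _).trans (Finset.sum_le_sum fun j _ => ?_)
        exact norm_sum_le _ _
    _ ≤ ∑ _i ∈ range (N + 1), ∑ _j ∈ range (N + 1), ∑ _l ∈ range (N + 1), P * X ^ (3 * N) :=
        Finset.sum_le_sum fun i hi => Finset.sum_le_sum fun j hj => Finset.sum_le_sum fun l hl => hterm i hi j hj l hl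
    _ = ((N : ℝ) + 1) ^ 3 * P * X ^ (3 * N) := by
        simp only [Finset.sum_const, Finset.card_range, nsmul_eq_mul]; push_cast; ring

/-- The weights of the affine substitution `x ↦ a + bx`: `w a b λ μ = binom(λ,μ) a^{λ-μ} b^μ`. [folklore] -/
def wSub (a b : ℂ) (n μ : ℕ) : ℂ := (n.choose μ : ℂ) * a ^ (n - μ) * b ^ μ

/-- **The binomial expansion** `(a + bx)^λ = ∑_{μ ≤ N} w a b λ μ x^μ` for `λ ≤ N`. [folklore] -/
theorem sum_wSub_mul_pow (a b x : ℂ) {N n : ℕ} (hn : n ≤ N) :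
    ∑ μ ∈ range (N + 1), wSub a b n μ * x ^ μ = (a + b * x) ^ n := by
  rw [show a + b * x = b * x + a by ring, add_pow]
  -- extend the range: the extra terms vanish (`choose = 0`)
  have hsplit : ∑ μ ∈ range (N + 1), wSub a b n μ * x ^ μ = ∑ μ ∈ range (n + 1), wSub a b n μ * x ^ μ := by
    refine (Finset.sum_subset (Finset.range_mono (by omega)) fun μ hμN hμn => ?_).symm
    have hlt : n < μ := by
      simp only [Finset.mem_range, not_lt] at hμn; omega
    simp [wSub, Nat.choose_eq_zero_of_lt hlt]
  rw [hsplit]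
  refine Finset.sum_congr rfl fun μ _ => ?_
  unfold wSub; ring

/-- The substituted coefficients: `q(μ₁,μ₂,μ₃) = ∑_λ p(λ) w₁(λ₁,μ₁) w₂(λ₂,μ₂) w₃(λ₃,μ₃)`.
[cite: Masser1975, §2.3 (the polynomial Q(x₀,x₁,x₂))] -/
def subQ (N : ℕ) (p : ℕ → ℕ → ℕ → ℂ) (a₁ b₁ a₂ b₂ a₃ b₃ : ℂ) : ℕ → ℕ → ℕ → ℂ := fun μ₁ μ₂ μ₃ =>
  ∑ i ∈ range (N + 1), ∑ j ∈ range (N + 1), ∑ l ∈ range (N + 1),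
    p i j l * wSub a₁ b₁ i μ₁ * wSub a₂ b₂ j μ₂ * wSub a₃ b₃ l μ₃

/-- **The substitution identity**:
`triEval N (subQ p) x₁ x₂ x₃ = ∑ p(λ) (a₁+b₁x₁)^{λ₁} (a₂+b₂x₂)^{λ₂} (a₃+b₃x₃)^{λ₃}`.
[cite: Masser1975, §2.3 (Q(ξ₀,ξ₁,ξ₂) = φ(z(r₀,r₁,r₂)))] -/
theorem triEval_subQ (N : ℕ) (p : ℕ → ℕ → ℕ → ℂ) (a₁ b₁ a₂ b₂ a₃ b₃ x₁ x₂ x₃ : ℂ) :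
    triEval N (subQ N p a₁ b₁ a₂ b₂ a₃ b₃) x₁ x₂ x₃ =
      ∑ i ∈ range (N + 1), ∑ j ∈ range (N + 1), ∑ l ∈ range (N + 1),
        p i j l * (a₁ + b₁ * x₁) ^ i * (a₂ + b₂ * x₂) ^ j * (a₃ + b₃ * x₃) ^ l := by
  set s := range (N + 1) with hs
  -- the common summand
  set T : ℕ → ℕ → ℕ → ℕ → ℕ → ℕ → ℂ := fun i j l μ₁ μ₂ μ₃ =>
    p i j l * wSub a₁ b₁ i μ₁ * wSub a₂ b₂ j μ₂ * wSub a₃ b₃ l μ₃ * x₁ ^ μ₁ * x₂ ^ μ₂ * x₃ ^ μ₃ with hT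
  -- the right-hand side is `∑_{ijl} ∑_{μ} T`
  have hR : ∀ i ∈ s, ∀ j ∈ s, ∀ l ∈ s,
      p i j l * (a₁ + b₁ * x₁) ^ i * (a₂ + b₂ * x₂) ^ j * (a₃ + b₃ * x₃) ^ l =
        ∑ μ₁ ∈ s, ∑ μ₂ ∈ s, ∑ μ₃ ∈ s, T i j l μ₁ μ₂ μ₃ := by
    intro i hi j hj l hl
    have hi' := Nat.lt_succ_iff.mp (Finset.mem_range.mp hi)
    have hj' := Nat.lt_succ_iff.mp (Finset.mem_range.mp hj)
    have hl' := Nat.lt_succ_iff.mp (Finset.mem_range.mp hl)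
    rw [← sum_wSub_mul_pow a₁ b₁ x₁ hi', ← sum_wSub_mul_pow a₂ b₂ x₂ hj', ← sum_wSub_mul_pow a₃ b₃ x₃ hl']
    rw [mul_assoc, mul_assoc, Finset.sum_mul_sum, Finset.sum_mul_sum]
    simp only [Finset.mul_sum]
    refine Finset.sum_congr rfl fun μ₁ _ => Finset.sum_congr rfl fun μ₂ _ => Finset.sum_congr rfl fun μ₃ _ => ?_
    simp only [hT]; ring
  rw [Finset.sum_congr rfl fun i hi => Finset.sum_congr rfl fun j hj => Finset.sum_congr rfl fun l hl => hR i hi j hj l hl]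
  -- the left-hand side is `∑_{μ} ∑_{ijl} T`
  have hL : triEval N (subQ N p a₁ b₁ a₂ b₂ a₃ b₃) x₁ x₂ x₃ =
      ∑ μ₁ ∈ s, ∑ μ₂ ∈ s, ∑ μ₃ ∈ s, ∑ i ∈ s, ∑ j ∈ s, ∑ l ∈ s, T i j l μ₁ μ₂ μ₃ := by
    rw [triEval_eq_sum]
    refine Finset.sum_congr rfl fun μ₁ _ => Finset.sum_congr rfl fun μ₂ _ => Finset.sum_congr rfl fun μ₃ _ => ?_
    unfold subQ
    simp only [Finset.sum_mul]
    rfl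
  rw [hL]
  -- reorder the two triple sums through product sets
  have h3 : ∀ (G : ℕ → ℕ → ℕ → ℂ), ∑ a ∈ s, ∑ b ∈ s, ∑ c ∈ s, G a b c =
      ∑ x ∈ s ×ˢ (s ×ˢ s), G x.1 x.2.1 x.2.2 := by
    intro G
    rw [Finset.sum_product]
    refine Finset.sum_congr rfl fun a _ => ?_
    rw [Finset.sum_product]
  calc ∑ μ₁ ∈ s, ∑ μ₂ ∈ s, ∑ μ₃ ∈ s, ∑ i ∈ s, ∑ j ∈ s, ∑ l ∈ s, T i j l μ₁ μ₂ μ₃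
      = ∑ y ∈ s ×ˢ (s ×ˢ s), ∑ x ∈ s ×ˢ (s ×ˢ s), T x.1 x.2.1 x.2.2 y.1 y.2.1 y.2.2 := by
        rw [h3]; refine Finset.sum_congr rfl fun y _ => ?_; rw [h3]
    _ = ∑ x ∈ s ×ˢ (s ×ˢ s), ∑ y ∈ s ×ˢ (s ×ˢ s), T x.1 x.2.1 x.2.2 y.1 y.2.1 y.2.2 := Finset.sum_comm
    _ = ∑ i ∈ s, ∑ j ∈ s, ∑ l ∈ s, ∑ μ₁ ∈ s, ∑ μ₂ ∈ s, ∑ μ₃ ∈ s, T i j l μ₁ μ₂ μ₃ := by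
        rw [h3]; refine Finset.sum_congr rfl fun x _ => ?_; rw [h3]

end Literature.NumberTheory.Transcendental.Masser1975
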